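import Literature.MathematicalPhysics.QuantumFieldTheory.WilsonFinTorusFiniteTemperatureDictionary
import Literature.Barriers.QuantumFields.FiniteTemperatureDeconfinementInfrared
import HarnessLib

/-!
# Slice-magnetisation correlations of the cold box are slice sums of Borgs–Seiler's Polyakov two-point function (heavy-twist wall)

HELPER 5/6 for the crux `BalabanLadder.IR` (stmt-QuantumFields-19354), line `heavy-twist` RUNG 2 on even boxes (wall seat
`ym-ir-wall-p1`; dictionaries D1∘D2 of the recipe ym-ir-crit-3 2026-08-28T07:11:56Z, assembled over ym-ir-lit-4's Literature parts 5–6: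
`WilsonFinTorusSliceObservables`, `WilsonFinTorusFiniteTemperatureDictionary`).  All PROVED, no definitions:

* `expectation_re_polyakovTrace_mul_conj` — the general-pair two-point function `⟨Re(χ(P_x) χ̄(P_y))⟩ = G_L(y − x)`
  (translation invariance `polyakovKernel_add`);
* `re_mul_conj_of_im_eq_zero` — for a representation with REAL characters (`Im tr ρ ≡ 0`, e.g. `SU(2)`),
  `Re(χ χ̄') = Re χ · Re χ'`;
* `expectation_polyakov_pair_eq_finTorusExpectation` — the general-pair dictionary: `⟨Re χ(P_x) Re χ(P_y)⟩^{FT}` is the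
  expectation, in the exchanged box `T × L × L × L` sliced along its last axis, of `Re tr ρ(P_{x⊥}(𝒰_{x₀})) · Re tr ρ(P_{y⊥}(𝒰_{y₀}))`;
* `finTorusExpectation_finSliceMagnetisation_mul` (**main**) — for real characters:
  `⟨m(𝒰₀) m(𝒰_s)⟩_{(T,L,L,L)} = L² Σ_{w ∈ (ℤ/L)²} G_L(s ∷ w)`, `m = finSliceMagnetisation ρ` (zero-momentum slice Polyakov loop),
  `G_L = FiniteTemperature.polyakovCorrelation ρ β β` at `L₀ = T` — the input `A(s)` of the sector Cauchy–Schwarz step.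

HONEST FRAMING: dictionaries and bookkeeping only; nothing here proves `BalabanLadder.IR`, its seed, or the Yang–Mills mass gap (Clay).
References: C. Borgs, E. Seiler, Commun. Math. Phys. 91 (1983) 329, §II.3 (II.22), §III.2; I. Montvay, G. Münster (1994) §3.2.6.
-/

set_option autoImplicit false

noncomputable section

open MeasureTheory
open scoped ComplexConjugate
open Literature.MathematicalPhysics.QuantumFieldTheory Literature.Barriers.QuantumFields
open Literature.Barriers.QuantumFields.FiniteTemperature
open Literature.Probability.LatticeModels (TorusSite)

namespace Summit.QuantumFields.YangMills.Cruxes.IR.HeavyTwistWall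

section Pair

variable {G : Type*} [Group G] [TopologicalSpace G] [IsTopologicalGroup G] [CompactSpace G] [MeasurableSpace G] [BorelSpace G]
  [SecondCountableTopology G] {N : ℕ} (ρ : G →* Matrix (Fin N) (Fin N) ℂ) {L T : ℕ} [NeZero L] [NeZero T]

/-- **General-pair Polyakov two-point function**: `⟨Re(χ(P_x) conj χ(P_y))⟩ = G_L(y − x)` (translation invariance of the
periodic box). -/
theorem expectation_re_polyakovTrace_mul_conj (hρ : Continuous ρ) (JE JM : ℝ) (x y : Fin 3 → ZMod L) :
    expectation ρ JE JM (fun U : Config 3 T L G => (polyakovTrace ρ U x * conj (polyakovTrace ρ U y)).re) =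
      polyakovCorrelation (L₀ := T) ρ JE JM (y - x) := by
  rw [polyakovCorrelation_eq_re_polyakovKernel ρ hρ]
  have hK : polyakovKernel (L₀ := T) ρ JE JM 0 (y - x) = polyakovKernel (L₀ := T) ρ JE JM x y := by
    have h := polyakovKernel_add (L₀ := T) ρ JE JM 0 (y - x) x
    rw [zero_add, sub_add_cancel] at h
    exact h.symm
  rw [hK]
  unfold expectation polyakovKernel
  rw [Complex.div_ofReal_re]
  congr 1
  have h := integral_re (integrable_polyakovKernel_integrand (L₀ := T) ρ hρ JE JM x y)
  simp only [RCLike.re_to_complex] at h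
  rw [← h]
  refine integral_congr_ae (Filter.Eventually.of_forall fun U => ?_)
  simp only [Complex.mul_re, Complex.ofReal_re, Complex.ofReal_im, mul_zero, sub_zero]

omit [TopologicalSpace G] [IsTopologicalGroup G] [CompactSpace G] [MeasurableSpace G] [BorelSpace G]
  [SecondCountableTopology G] [NeZero L] [NeZero T] in
/-- For real characters, `Re(a conj b) = Re a · Re b`. -/
theorem re_mul_conj_of_im_eq_zero {a b : ℂ} (ha : a.im = 0) (hb : b.im = 0) : (a * conj b).re = a.re * b.re := by
  simp [Complex.mul_re, ha, hb]

/-- **The general-pair dictionary.**  For unitary continuous `ρ` and `x, y ∈ (ℤ/L)³` with `Fin`-coordinates `x̃, ỹ`: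
`⟨Re χ(P_x) · Re χ(P_y)⟩^{FT}_{β,β} = ⟨Re tr ρ(P_{(x̃₁,x̃₂)}(𝒰_{x̃₀})) · Re tr ρ(P_{(ỹ₁,ỹ₂)}(𝒰_{ỹ₀}))⟩_{(T,L,L,L)}` (box exchanged
`0 ↔ 3`, sliced along its last axis; `P_q = finSlicePolyakovHolonomy`, `𝒰_t = finTorusSlice`). -/
theorem expectation_polyakov_pair_eq_finTorusExpectation (hρ : Continuous ρ)
    (hρu : ∀ g, ρ g ∈ Matrix.unitaryGroup (Fin N) ℂ) (β : ℝ) (x y : Fin 3 → ZMod L) :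
    expectation ρ β β (fun U : Config 3 T L G => (polyakovTrace ρ U x).re * (polyakovTrace ρ U y).re) =
      finTorusExpectation ρ β fun V' : FinTorusSite T L L L × Fin 4 → G =>
        (ρ (finSlicePolyakovHolonomy (finTorusSlice V' ((ZMod.finEquiv L).symm (x 0)))
          ((ZMod.finEquiv L).symm (x 1), (ZMod.finEquiv L).symm (x 2)))).trace.re *
        (ρ (finSlicePolyakovHolonomy (finTorusSlice V' ((ZMod.finEquiv L).symm (y 0)))
          ((ZMod.finEquiv L).symm (y 1), (ZMod.finEquiv L).symm (y 2)))).trace.re := by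
  rw [expectation_eq_finTorusExpectation ρ hρu β, finTorusExpectation_swap03 ρ hρ β]
  congr 1
  funext V'
  simp only [polyakovTrace, polyakovLine_eq_finTorusTimeLine, MeasurableEquiv.apply_symm_apply, finTorusTimeLine_swap03]

end Pair

/-! ## The slice-magnetisation correlation as a slice sum of `G_L` -/

section Magnetisation

variable {G : Type*} [Group G] [TopologicalSpace G] [IsTopologicalGroup G] [CompactSpace G] [MeasurableSpace G] [BorelSpace G]
  [SecondCountableTopology G] {N : ℕ} (ρ : G →* Matrix (Fin N) (Fin N) ℂ) {L T : ℕ} [NeZero L] [NeZero T]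

/-- Linearity of the `Fin`-box expectation over a finite double sum of bounded continuous observables. -/
theorem finTorusExpectation_sum_sum (hρ : Continuous ρ) (β : ℝ) {n₀ n₁ n₂ n₃ : ℕ} {ι κ : Type*} [Fintype ι] [Fintype κ]
    (Φ : ι → κ → (FinTorusSite n₀ n₁ n₂ n₃ × Fin 4 → G) → ℝ) (hΦ : ∀ i k, Continuous (Φ i k)) :
    finTorusExpectation ρ β (fun V => ∑ i, ∑ k, Φ i k V) = ∑ i, ∑ k, finTorusExpectation ρ β (Φ i k) := by
  simp only [finTorusExpectation_eq_div]
  simp_rw [← Finset.sum_div]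
  congr 1
  have hint : ∀ i k, Integrable (fun V : FinTorusSite n₀ n₁ n₂ n₃ × Fin 4 → G => Φ i k V * finTorusTwistedWeight ρ β 1 V)
      (Measure.pi fun _ : FinTorusSite n₀ n₁ n₂ n₃ × Fin 4 => haarProbability G) := fun i k =>
    ((hΦ i k).mul (continuous_finTorusTwistedWeight' ρ hρ β 1)).integrable_of_hasCompactSupport
      (IsCompact.of_isClosed_subset isCompact_univ (isClosed_tsupport _) (Set.subset_univ _))
  simp_rw [Finset.sum_mul]
  rw [integral_finsetSum _ (fun i _ => integrable_finsetSum _ fun k _ => hint i k)]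
  refine Finset.sum_congr rfl fun i _ => ?_
  rw [integral_finsetSum _ (fun k _ => hint i k)]

omit [CompactSpace G] [MeasurableSpace G] [BorelSpace G] [SecondCountableTopology G] [NeZero L] [NeZero T] in
/-- Continuity of `V' ↦ Re tr ρ(P_q(𝒰_t(V')))`. -/
theorem continuous_re_trace_slicePolyakov (hρ : Continuous ρ) {n₀ n₁ n₂ n₃ : ℕ} (t : Fin n₃) (q : Fin n₁ × Fin n₂) :
    Continuous fun V' : FinTorusSite n₀ n₁ n₂ n₃ × Fin 4 → G =>
      (ρ (finSlicePolyakovHolonomy (finTorusSlice V' t) q)).trace.re :=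
  Complex.continuous_re.comp ((Continuous.matrix_trace hρ).comp
    ((continuous_finSlicePolyakovHolonomy q).comp ((continuous_apply t).comp continuous_finTorusSlice)))

omit [TopologicalSpace G] [IsTopologicalGroup G] [CompactSpace G] [MeasurableSpace G] [BorelSpace G]
  [SecondCountableTopology G] [NeZero T] in
/-- The transverse re-centring bijection `q' ↦ (q'₁ − q₁, q'₂ − q₂)` from `Fin L × Fin L` onto `(ℤ/L)²`. -/
theorem sum_comp_sub_eq_sum (q : Fin L × Fin L) (F : TorusSite 2 L → ℝ) :
    ∑ q' : Fin L × Fin L, F ![ZMod.finEquiv L q'.1 - ZMod.finEquiv L q.1, ZMod.finEquiv L q'.2 - ZMod.finEquiv L q.2] =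
      ∑ w : TorusSite 2 L, F w := by
  refine Fintype.sum_equiv
    ⟨fun q' : Fin L × Fin L => ![ZMod.finEquiv L q'.1 - ZMod.finEquiv L q.1, ZMod.finEquiv L q'.2 - ZMod.finEquiv L q.2],
      fun w : TorusSite 2 L =>
        ((ZMod.finEquiv L).symm (w 0 + ZMod.finEquiv L q.1), (ZMod.finEquiv L).symm (w 1 + ZMod.finEquiv L q.2)),
      fun q' => ?_, fun w => ?_⟩ _ _ fun q' => rfl
  · simp
  · funext i
    fin_cases i <;> simp

/-- **The slice-magnetisation correlation is a slice sum of Borgs–Seiler's Polyakov two-point function** (real characters,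
unitary continuous `ρ`; box `T × L × L × L` sliced along its last axis, period `L`):
`⟨m(𝒰₀) · m(𝒰_s)⟩ = L² Σ_{w ∈ (ℤ/L)²} G_L(s ∷ w)`, where `m = finSliceMagnetisation ρ` and `G_L = polyakovCorrelation ρ β β` at temporal
extent `L₀ = T` (expand both magnetisations, dictionary pair by pair, translation invariance, re-centre the transverse sum). -/
theorem finTorusExpectation_finSliceMagnetisation_mul (hρ : Continuous ρ) (hρu : ∀ g, ρ g ∈ Matrix.unitaryGroup (Fin N) ℂ)
    (hreal : ∀ g, (ρ g).trace.im = 0) (β : ℝ) (s : Fin L) :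
    finTorusExpectation ρ β (fun V' : FinTorusSite T L L L × Fin 4 → G =>
        finSliceMagnetisation ρ (finTorusSlice V' 0) * finSliceMagnetisation ρ (finTorusSlice V' s)) =
      (L : ℝ) ^ 2 * ∑ w : TorusSite 2 L, polyakovCorrelation (L₀ := T) ρ β β (Fin.cons (ZMod.finEquiv L s) w) := by
  -- expand the two magnetisations
  have hexp : (fun V' : FinTorusSite T L L L × Fin 4 → G =>
      finSliceMagnetisation ρ (finTorusSlice V' 0) * finSliceMagnetisation ρ (finTorusSlice V' s)) =
      fun V' => ∑ q : Fin L × Fin L, ∑ q' : Fin L × Fin L,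
        (ρ (finSlicePolyakovHolonomy (finTorusSlice V' 0) q)).trace.re *
          (ρ (finSlicePolyakovHolonomy (finTorusSlice V' s) q')).trace.re := by
    funext V'
    simp only [finSliceMagnetisation_eq_sum, Finset.sum_mul_sum]
  rw [hexp, finTorusExpectation_sum_sum ρ hρ β
    (fun (q q' : Fin L × Fin L) (V' : FinTorusSite T L L L × Fin 4 → G) =>
      (ρ (finSlicePolyakovHolonomy (finTorusSlice V' 0) q)).trace.re *
        (ρ (finSlicePolyakovHolonomy (finTorusSlice V' s) q')).trace.re)
    (fun q q' => (continuous_re_trace_slicePolyakov ρ hρ 0 q).mul (continuous_re_trace_slicePolyakov ρ hρ s q'))]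
  -- each pair is a Polyakov two-point function of the finite-temperature box at separation `(s, q' − q)`
  have hpair : ∀ q q' : Fin L × Fin L,
      finTorusExpectation ρ β (fun V' : FinTorusSite T L L L × Fin 4 → G =>
        (ρ (finSlicePolyakovHolonomy (finTorusSlice V' 0) q)).trace.re *
          (ρ (finSlicePolyakovHolonomy (finTorusSlice V' s) q')).trace.re) =
        polyakovCorrelation (L₀ := T) ρ β β
          (Fin.cons (ZMod.finEquiv L s) ![ZMod.finEquiv L q'.1 - ZMod.finEquiv L q.1, ZMod.finEquiv L q'.2 - ZMod.finEquiv L q.2]) := by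
    intro q q'
    have h := expectation_polyakov_pair_eq_finTorusExpectation (T := T) ρ hρ hρu β
      ![0, ZMod.finEquiv L q.1, ZMod.finEquiv L q.2] ![ZMod.finEquiv L s, ZMod.finEquiv L q'.1, ZMod.finEquiv L q'.2]
    simp only [Matrix.cons_val_zero, Matrix.cons_val_one, Matrix.cons_val_two, Matrix.head_cons, Matrix.tail_cons,
      map_zero, RingEquiv.symm_apply_apply] at h
    rw [← h]
    have hre : (fun U : Config 3 T L G => (polyakovTrace ρ U ![0, ZMod.finEquiv L q.1, ZMod.finEquiv L q.2]).re *
        (polyakovTrace ρ U ![ZMod.finEquiv L s, ZMod.finEquiv L q'.1, ZMod.finEquiv L q'.2]).re) =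
        fun U => (polyakovTrace ρ U ![0, ZMod.finEquiv L q.1, ZMod.finEquiv L q.2] *
          conj (polyakovTrace ρ U ![ZMod.finEquiv L s, ZMod.finEquiv L q'.1, ZMod.finEquiv L q'.2])).re := by
      funext U
      exact (re_mul_conj_of_im_eq_zero (hreal _) (hreal _)).symm
    rw [hre, expectation_re_polyakovTrace_mul_conj ρ hρ]
    congr 1
    funext i
    refine Fin.cases ?_ (fun j => ?_) i
    · simp
    · fin_cases j <;> simp
  simp_rw [hpair]
  rw [Finset.sum_congr rfl fun q _ => sum_comp_sub_eq_sum q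
    (fun w => polyakovCorrelation (L₀ := T) ρ β β (Fin.cons (ZMod.finEquiv L s) w)), Finset.sum_const, Finset.card_univ,
    Fintype.card_prod, Fintype.card_fin, nsmul_eq_mul]
  push_cast
  ring


end Magnetisation

end Summit.QuantumFields.YangMills.Cruxes.IR.HeavyTwistWall

end
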